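import Mathlib
import Summits.AtomisticToContinuum.HydrodynamicLimit.Theorems.ImplosionDichotomyDenseExcursionCavityUniformEnergyFlux
import Summits.AtomisticToContinuum.HydrodynamicLimit.Theorems.ImplosionDichotomyDenseExcursionSonicConfinementCharacteristic
import Literature.Analysis.ODE.BarrierTouchingComplex

/-!
# The outer zone of the energy regime: `|p|, |m| = O(N)` on `8e^{−x} ≤ Re Λ`, `x ≤ 1`
# (crux `DenseExcursion`, line `sonic-cavity-renewal`, bricks for stub `stub_cavityResolventCk`, theorem T7(iii))

Helper file (`--supports stmt-AtomisticToContinuum-12586`, line lead a2, stub-worker E3 for `stub_cavityResolventCk`,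
energy regime `Re Λ → +∞`).

**Mathematics.** Write the resolvent equations `Λŵ − linW = f`, `Λŝ − linS = g` in characteristic form
(`char_system_src`, the sourced version of `mode_char_system`):
`c₊ p′ = (Λ − b₊₊)p − b₊₋ m − (f + 3g)`, `c₋ m′ = −b₋₊ p + (Λ − b₋₋) m − (f − 3g)`, `p = ŵ + 3ŝ`, `m = ŵ − 3ŝ`.
On the OUTER ZONE `x_e ≤ x ≤ 1`, `x_e = log(8/Re Λ)` (so `S ≤ e^{−x} ≤ Re Λ/8` there) and for `Re Λ ≥ 48`:
(i) the energy flux inequality `cavity_energy_flux` gives `|m| ≤ |p| + (11/10)N` pointwise (`outer_m_arith`);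
(ii) the `p`-field is REPULSIVE-DISSIPATIVE: at a point of `[x_e, 1]` where `|p|` is maximal the complex touching lemma
(`Literature.Analysis.ODE.barrier_touching_complex`, both endpoints are outflow: `c₊(x_e) > 0`, `c₊(1) < 0`, and the sonic
point in between costs nothing) gives `sup|p|·(Re Λ − b₊₊) ≤ |b₊₋||m| + |f| + 3|g|`, and the tube envelope
(`b₊₊ ≤ 1/12 + 2S`, `|b₊₋| ≤ 19/24 + S`, `S ≤ Re Λ/8`) closes to `sup_{[x_e,1]} |p| ≤ N` (`outer_p_arith`).
Hence `|ŵ + 3ŝ| ≤ N`, `|ŵ − 3ŝ| ≤ 3N` on the outer zone (`cavity_outer_bound`), uniformly in `Im Λ`.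
Sources: folklore (Courant–Friedrichs 1948; Protter–Weinberger 1984 Ch. 1). NOT here: the junction and deep zones
(`e^{−x} > Re Λ/8`) and the assembly (next files of worker E3).
-/

noncomputable section

open Filter Set
open scoped Topology ContDiff

namespace Summit.AtomisticToContinuum.HydrodynamicLimit.Theorems.SonicCavityRenewal

open Summit.AtomisticToContinuum.HydrodynamicLimit.Theorems.R2OneModeTwoConditions
open Literature.Analysis.ODE

/-! ## The characteristic system with a source -/

/-- THE CHARACTERISTIC SYSTEM WITH A SOURCE (pointwise algebra): the resolvent equations at `x` are equivalent to
`c₊ (ŵ′ + 3ŝ′) = (Λ − b₊₊)(ŵ + 3ŝ) − b₊₋ (ŵ − 3ŝ) − (f + 3g)` and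
`c₋ (ŵ′ − 3ŝ′) = −b₋₊ (ŵ + 3ŝ) + (Λ − b₋₋)(ŵ − 3ŝ) − (f − 3g)`. [folklore] -/
theorem char_system_src {r : ℝ} {W S : ℝ → ℝ} {Λ : ℂ} {ŵ ŝ f g : ℝ → ℂ} {x : ℝ}
    (h : Λ * ŵ x - linW r W S ŵ ŝ x = f x ∧ Λ * ŝ x - linS r W S ŵ ŝ x = g x) :
    ((W x - 1 + S x : ℝ) : ℂ) * (deriv ŵ x + 3 * deriv ŝ x) =
        (Λ - ((2 / 3 * deriv W x + 2 * W x - r + 2 * deriv S x + 4 * S x : ℝ) : ℂ)) * (ŵ x + 3 * ŝ x) -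
          ((deriv W x / 3 + deriv S x + 2 * S x : ℝ) : ℂ) * (ŵ x - 3 * ŝ x) - (f x + 3 * g x) ∧
      ((W x - 1 - S x : ℝ) : ℂ) * (deriv ŵ x - 3 * deriv ŝ x) =
        -((deriv W x / 3 - deriv S x - 2 * S x : ℝ) : ℂ) * (ŵ x + 3 * ŝ x) +
          (Λ - ((2 / 3 * deriv W x + 2 * W x - r - 2 * deriv S x - 4 * S x : ℝ) : ℂ)) * (ŵ x - 3 * ŝ x) -
          (f x - 3 * g x) := by
  obtain ⟨h1, h2⟩ := h
  unfold linW at h1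
  unfold linS at h2
  push_cast at h1 h2 ⊢
  constructor
  · linear_combination (-1 : ℂ) * h1 - 3 * h2
  · linear_combination (-1 : ℂ) * h1 + 3 * h2

/-! ## Real arithmetic of the outer zone -/

/-- OUTER-ZONE ARITHMETIC FOR `m`: from the flux inequality `(1 − W + S)M² ≤ (W − 1 + S)P² + 2N²(1/5 + 3e²)/(X − 3)`
(`e = e^{−x}`), `|W| ≤ 1/4`, `(7/10)e ≤ S`, `8e ≤ X`, `X ≥ 48`: `M ≤ P + (11/10)N`. [folklore] -/
theorem outer_m_arith (Wv Sv P M N X e : ℝ) (hW : |Wv| ≤ 1 / 4) (hS7 : 7 / 10 * e ≤ Sv) (heX : 8 * e ≤ X)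
    (hX : 48 ≤ X) (he : 0 < e) (hP : 0 ≤ P) (hM : 0 ≤ M) (hN : 0 ≤ N)
    (hflux : (1 - Wv + Sv) * M ^ 2 ≤ (Wv - 1 + Sv) * P ^ 2 + 2 * N ^ 2 * (1 / 5 + 3 * e ^ 2) / (X - 3)) :
    M ≤ P + 11 / 10 * N := by
  obtain ⟨hW₁, hW₂⟩ := abs_le.mp hW
  have hX3 : 0 < X - 3 := by linarith
  set D : ℝ := 1 - Wv + Sv with hD
  have hD0 : 3 / 4 + 7 / 10 * e ≤ D := by simp only [hD]; linarith
  have hDpos : 0 < D := by linarith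
  -- step 1: `D M² ≤ D P² + ρ`
  have h1 : D * M ^ 2 ≤ D * P ^ 2 + 2 * N ^ 2 * (1 / 5 + 3 * e ^ 2) / (X - 3) := by
    have : (Wv - 1 + Sv) * P ^ 2 ≤ D * P ^ 2 := mul_le_mul_of_nonneg_right (by simp only [hD]; linarith) (sq_nonneg P)
    linarith
  -- step 2: `ρ ≤ (121/100) D N²`
  have h2 : 2 * N ^ 2 * (1 / 5 + 3 * e ^ 2) / (X - 3) ≤ 121 / 100 * D * N ^ 2 := by
    rw [div_le_iff₀ hX3]
    have hcore : 2 * (1 / 5 + 3 * e ^ 2) ≤ 121 / 100 * D * (X - 3) := by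
      have he2 : e ^ 2 ≤ e * (X / 8) := by rw [sq]; exact mul_le_mul_of_nonneg_left (by linarith) he.le
      have hk : 121 / 100 * (3 / 4 + 7 / 10 * e) * (X - 3) ≤ 121 / 100 * D * (X - 3) :=
        mul_le_mul_of_nonneg_right (mul_le_mul_of_nonneg_left hD0 (by norm_num)) hX3.le
      nlinarith
    have hN2 : 0 ≤ N ^ 2 := sq_nonneg N
    calc 2 * N ^ 2 * (1 / 5 + 3 * e ^ 2) = N ^ 2 * (2 * (1 / 5 + 3 * e ^ 2)) := by ring
      _ ≤ N ^ 2 * (121 / 100 * D * (X - 3)) := mul_le_mul_of_nonneg_left hcore hN2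
      _ = 121 / 100 * D * N ^ 2 * (X - 3) := by ring
  -- step 3: `M² ≤ (P + 11/10 N)²`
  have h3 : D * M ^ 2 ≤ D * (P + 11 / 10 * N) ^ 2 := by
    have hPN : 0 ≤ D * (P * N) := mul_nonneg hDpos.le (mul_nonneg hP hN)
    nlinarith
  have h4 : M ^ 2 ≤ (P + 11 / 10 * N) ^ 2 := le_of_mul_le_mul_left h3 hDpos
  exact (pow_le_pow_iff_left₀ hM (by positivity) two_ne_zero).mp h4

/-- OUTER-ZONE ARITHMETIC FOR `p`: the touching inequality `Sp·(X − b₊₊) ≤ |b₊₋| M + |f| + 3|g|` with the tube envelope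
(`|W| ≤ 1/4`, `|W′| ≤ 1/2`, `|S + S′| ≤ 3/8 − W`, `r > 1`, `0 ≤ S ≤ e`, `8e ≤ X`, `X ≥ 48`), `M ≤ Sp + (11/10)N`,
`|f| ≤ N`, `|g| ≤ N e` forces `Sp ≤ N`. [folklore] -/
theorem outer_p_arith (r Wv W' Sv S' Sp M Fn Gn N X e : ℝ) (hW : |Wv| ≤ 1 / 4) (hW' : |W'| ≤ 1 / 2)
    (hσ : |Sv + S'| ≤ 3 / 8 - Wv) (hr : 1 < r) (hS0 : 0 ≤ Sv) (hSe : Sv ≤ e) (heX : 8 * e ≤ X) (hX : 48 ≤ X)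
    (hSp : 0 ≤ Sp) (hM0 : 0 ≤ M) (hN : 0 ≤ N) (hM : M ≤ Sp + 11 / 10 * N) (hFn : Fn ≤ N) (hGn : Gn ≤ N * e)
    (htouch : Sp * (X - (2 / 3 * W' + 2 * Wv - r + 2 * S' + 4 * Sv)) ≤
      |W' / 3 + S' + 2 * Sv| * M + Fn + 3 * Gn) : Sp ≤ N := by
  obtain ⟨hW₁, hW₂⟩ := abs_le.mp hW
  obtain ⟨hW₁', hW₂'⟩ := abs_le.mp hW'
  obtain ⟨hσ₁, hσ₂⟩ := abs_le.mp hσ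
  -- envelope of the coefficients
  have hbpp : 2 / 3 * W' + 2 * Wv - r + 2 * S' + 4 * Sv ≤ 1 / 12 + 2 * Sv := by linarith
  have hbpm : |W' / 3 + S' + 2 * Sv| ≤ 19 / 24 + Sv :=
    abs_le.mpr ⟨by linarith, by linarith⟩
  -- `Sp · A ≤ N · Bc` with `Bc ≤ A`, `A > 0`
  have hprod : |W' / 3 + S' + 2 * Sv| * M ≤ (19 / 24 + Sv) * (Sp + 11 / 10 * N) :=
    mul_le_mul hbpm hM hM0 (by linarith)
  have hkey : Sp * (X - 7 / 8 - 3 * Sv) ≤ N * (1871 / 1000 + 11 / 10 * Sv + 3 * e) := by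
    have h1 : Sp * (X - (1 / 12 + 2 * Sv)) ≤ Sp * (X - (2 / 3 * W' + 2 * Wv - r + 2 * S' + 4 * Sv)) :=
      mul_le_mul_of_nonneg_left (by linarith) hSp
    nlinarith
  have hA : 0 < X - 7 / 8 - 3 * Sv := by nlinarith
  have hBc : 1871 / 1000 + 11 / 10 * Sv + 3 * e ≤ X - 7 / 8 - 3 * Sv := by nlinarith
  have hfin : Sp * (X - 7 / 8 - 3 * Sv) ≤ N * (X - 7 / 8 - 3 * Sv) :=
    hkey.trans (mul_le_mul_of_nonneg_left hBc hN)
  exact le_of_mul_le_mul_right hfin hA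

/-! ## The outer-zone bound -/

/-- **Registered helper `cavity_outer_bound` (worker E3, theorem T7(iii) of `stub_cavityResolventCk`): THE OUTER ZONE OF THE
ENERGY REGIME.** For a monatomic tube profile, `Re Λ ≥ 48`, a differentiable pair `(ŵ, ŝ)` with finite weighted sup on
`x ≤ 1` solving the resolvent equations with source `|f| + eˣ|g| ≤ N` on `x ≤ 1`: on the outer zone `8e^{−x} ≤ Re Λ`,
`x ≤ 1` one has `|ŵ + 3ŝ| ≤ N` and `|ŵ − 3ŝ| ≤ 3N` (repulsive-dissipative transport of `p` between two outflow endpoints +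
the energy flux bound of `m`; uniform in `Im Λ`). [folklore] -/
theorem cavity_outer_bound : ∀ (r : ℝ) (W S : ℝ → ℝ), IsMonatomicProfile r W S → CavityTube r W S → ∀ (Λ : ℂ) (f g ŵ ŝ : ℝ → ℂ) (N B : ℝ), 48 ≤ Λ.re → Differentiable ℝ ŵ → Differentiable ℝ ŝ → (∀ x, x ≤ 1 → Λ * ŵ x - linW r W S ŵ ŝ x = f x ∧ Λ * ŝ x - linS r W S ŵ ŝ x = g x) → (∀ x, x ≤ 1 → ‖f x‖ + Real.exp x * ‖g x‖ ≤ N) → (∀ x, x ≤ 1 → ‖ŵ x‖ + Real.exp x * ‖ŝ x‖ ≤ B) → ∀ x, x ≤ 1 → 8 * Real.exp (-x) ≤ Λ.re → ‖ŵ x + 3 * ŝ x‖ ≤ N ∧ ‖ŵ x - 3 * ŝ x‖ ≤ 3 * N := by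
  intro r W S hP hT Λ f g ŵ ŝ N B hX hŵ hŝ hsol hsrc hB x hx1 hxe
  have hflux := cavity_energy_flux r W S hP hT Λ f g ŵ ŝ N B (by linarith) hŵ hŝ hsol hsrc hB
  obtain ⟨hr, -, hW, hS, hSpos, -⟩ := hP
  obtain ⟨h0, hsup, hsub, -, -, -, hang, hWenv, hSenv, -⟩ := hT
  have hS1 : Differentiable ℝ S := hS.differentiable (by simp)
  set X : ℝ := Λ.re with hXdef
  have hXpos : 0 < X := by linarith
  -- `N ≥ 0`
  have hN : 0 ≤ N := by
    have h := hsrc 0 (by norm_num)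
    have : 0 ≤ ‖f 0‖ + Real.exp 0 * ‖g 0‖ := by positivity
    linarith
  -- the zone edge `x_e = log (8/X) < 0`
  set xe : ℝ := Real.log (8 / X) with hxedef
  have h8X : 0 < 8 / X := by positivity
  have hxe0 : xe < 0 := Real.log_neg h8X (by rw [div_lt_one hXpos]; linarith)
  have hexe : Real.exp (-xe) = X / 8 := by
    rw [hxedef, Real.exp_neg, Real.exp_log h8X, inv_div]
  -- pointwise facts on the zone
  have zone : ∀ y ∈ Icc xe 1, Real.exp (-y) ≤ X / 8 ∧ S y ≤ Real.exp (-y) ∧ 7 / 10 * Real.exp (-y) ≤ S y := by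
    intro y hy
    obtain ⟨h7, h1, -, -⟩ := hSenv y hy.2
    have hey : 0 < Real.exp (-y) := Real.exp_pos _
    have hinv : Real.exp (-y) * Real.exp y = 1 := by rw [← Real.exp_add, neg_add_cancel, Real.exp_zero]
    refine ⟨?_, ?_, ?_⟩
    · rw [← hexe]; exact Real.exp_le_exp.mpr (neg_le_neg hy.1)
    · have := mul_le_mul_of_nonneg_left h1 hey.le
      rwa [← mul_assoc, hinv, one_mul, mul_one] at this
    · have := mul_le_mul_of_nonneg_left h7 hey.le
      rwa [← mul_assoc, hinv, one_mul, mul_comm] at this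
  -- (i) the `m`-bound from the flux, pointwise on the zone
  have hmle : ∀ y ∈ Icc xe 1, ‖ŵ y - 3 * ŝ y‖ ≤ ‖ŵ y + 3 * ŝ y‖ + 11 / 10 * N := by
    intro y hy
    obtain ⟨heX, -, hS7⟩ := zone y hy
    obtain ⟨hWy, -, -⟩ := hWenv y hy.2
    have hf := hflux y hy.2
    have he2 : Real.exp (-2 * y) = Real.exp (-y) ^ 2 := by
      rw [← Real.exp_nat_mul]; congr 1; ring
    rw [he2] at hf
    exact outer_m_arith (W y) (S y) _ _ N X (Real.exp (-y)) hWy hS7 (by linarith) hX (Real.exp_pos _)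
      (norm_nonneg _) (norm_nonneg _) hN hf
  -- (ii) the maximum of `|p|` on `[x_e, 1]`
  have hx_mem : x ∈ Icc xe 1 := by
    refine ⟨?_, hx1⟩
    have h1 : Real.exp (-x) ≤ Real.exp (-xe) := by rw [hexe]; linarith
    have := Real.exp_le_exp.mp h1
    linarith
  have hpc : ContinuousOn (fun y => ‖ŵ y + 3 * ŝ y‖) (Icc xe 1) :=
    ((hŵ.continuous.add (continuous_const.mul hŝ.continuous)).norm).continuousOn
  obtain ⟨xs, hxs, hmax⟩ := (isCompact_Icc : IsCompact (Icc xe 1)).exists_isMaxOn ⟨x, hx_mem⟩ hpc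
  set Sp : ℝ := ‖ŵ xs + 3 * ŝ xs‖ with hSpdef
  -- the touching inequality at `xs`
  have htouch : Sp * (X - (2 / 3 * deriv W xs + 2 * W xs - r + 2 * deriv S xs + 4 * S xs)) ≤
      |deriv W xs / 3 + deriv S xs + 2 * S xs| * ‖ŵ xs - 3 * ŝ xs‖ + ‖f xs‖ + 3 * ‖g xs‖ := by
    obtain ⟨c1, -⟩ := char_system_src (hsol xs hxs.2)
    obtain ⟨dp, -⟩ := hasDerivAt_char_components (hŵ xs) (hŝ xs)
    have hode : ((W xs - 1 + S xs : ℝ) : ℂ) * (deriv ŵ xs + 3 * deriv ŝ xs) =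
        (Λ - ((2 / 3 * deriv W xs + 2 * W xs - r + 2 * deriv S xs + 4 * S xs : ℝ) : ℂ)) * (ŵ xs + 3 * ŝ xs) -
        (((deriv W xs / 3 + deriv S xs + 2 * S xs : ℝ) : ℂ) * (ŵ xs - 3 * ŝ xs) + (f xs + 3 * g xs)) := by
      rw [c1]; ring
    have hmax' : IsMaxOn (fun y => ‖ŵ y + 3 * ŝ y‖ / (fun _ => (1 : ℝ)) y) (Icc xe 1) xs := by
      intro y hy; simpa using hmax hy
    have hleft : xs = xe → 0 ≤ W xs - 1 + S xs := by
      intro h; have := hsup xs (by rw [h]; exact hxe0); linarith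
    have hright : xs = 1 → W xs - 1 + S xs ≤ 0 := by
      intro h; have := hsub xs (by rw [h]; norm_num); linarith
    have key := barrier_touching_complex (yb := fun _ => (1 : ℝ)) (yb' := 0) hxs dp (hasDerivAt_const xs 1)
      (fun _ _ => one_pos) hmax' hode hleft hright
    simp only [div_one, mul_one, mul_zero, sub_zero, Complex.sub_re, Complex.ofReal_re] at key
    refine key.trans ?_
    calc ‖((deriv W xs / 3 + deriv S xs + 2 * S xs : ℝ) : ℂ) * (ŵ xs - 3 * ŝ xs) + (f xs + 3 * g xs)‖
        ≤ ‖((deriv W xs / 3 + deriv S xs + 2 * S xs : ℝ) : ℂ) * (ŵ xs - 3 * ŝ xs)‖ + ‖f xs + 3 * g xs‖ :=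
          norm_add_le _ _
      _ ≤ |deriv W xs / 3 + deriv S xs + 2 * S xs| * ‖ŵ xs - 3 * ŝ xs‖ + (‖f xs‖ + 3 * ‖g xs‖) := by
          gcongr
          · rw [norm_mul, Complex.norm_real, Real.norm_eq_abs]
          · calc ‖f xs + 3 * g xs‖ ≤ ‖f xs‖ + ‖3 * g xs‖ := norm_add_le _ _
              _ = ‖f xs‖ + 3 * ‖g xs‖ := by rw [norm_mul]; norm_num
      _ = _ := by ring
  -- the arithmetic at `xs`
  have hSpN : Sp ≤ N := by
    obtain ⟨heX, hSe, -⟩ := zone xs hxs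
    obtain ⟨hWs, hW's, -⟩ := hWenv xs hxs.2
    have hσ : |S xs + deriv S xs| ≤ 3 / 8 - W xs := by
      have h := hang xs hxs.2
      exact abs_le.mpr ⟨by linarith [neg_abs_le (S xs + deriv S xs)], by linarith [le_abs_self (S xs + deriv S xs)]⟩
    have hfg := hsrc xs hxs.2
    have hg0 : 0 ≤ ‖g xs‖ := norm_nonneg _
    have hf0 : 0 ≤ ‖f xs‖ := norm_nonneg _
    have hexs : 0 < Real.exp xs := Real.exp_pos xs
    have hFn : ‖f xs‖ ≤ N := by nlinarith
    have hGn : ‖g xs‖ ≤ N * Real.exp (-xs) := by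
      have h1 : Real.exp xs * ‖g xs‖ ≤ N := by linarith
      have h2 := mul_le_mul_of_nonneg_left h1 (Real.exp_pos (-xs)).le
      rwa [← mul_assoc, ← Real.exp_add, neg_add_cancel, Real.exp_zero, one_mul, mul_comm] at h2
    exact outer_p_arith r (W xs) (deriv W xs) (S xs) (deriv S xs) Sp _ _ _ N X (Real.exp (-xs)) hWs hW's hσ hr
      (hSpos xs).le hSe (by linarith) hX (norm_nonneg _) (norm_nonneg _) hN (hmle xs hxs) hFn hGn htouch
  -- conclusion at `x`
  have hpx : ‖ŵ x + 3 * ŝ x‖ ≤ N := (hmax hx_mem).trans hSpN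
  refine ⟨hpx, ?_⟩
  have := hmle x hx_mem
  linarith

end Summit.AtomisticToContinuum.HydrodynamicLimit.Theorems.SonicCavityRenewal

end
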